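import Summits.QuantumFields.BalabanUV.T4Continuum.Spine.NE3.PairLandauB8Avg
import Summits.QuantumFields.BalabanUV.T4Continuum.Support.NE3CurlPairedResidualGaugeQuotient
import Summits.QuantumFields.BalabanUV.T4Continuum.Support.NE3FramePotBoundWClass
import Summits.QuantumFields.BalabanUV.T4Continuum.Support.NE3CurvedFrameKill
import Summits.QuantumFields.BalabanUV.T4Continuum.Support.NE3CurlOfGaugeDir
import Summits.QuantumFields.BalabanUV.T4Continuum.Support.NE3ProductPathBounds
import HarnessLib

/-!
# T⁴ programme, node NE3 — census row R25 DISCHARGED IN THE ENERGY CURRENCY: THE TANGENT PROJECTION BOUND ON B8's SLICE `slicB8` IS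
# KINEMATIC AND k-FREE (corner-spike gauge correction; `d ≥ 3`, `L ≥ 2`)

Cell `pub-balaban-gaps` (YM blitz, track G2, seat `ne3`, unit `pub-balaban-gaps-ne3`; writer prover-pub-balaban-gaps-ne3-g4-0, 2026-08-23), repair R25 of
`run/shared/lean/pub/pub-balaban-gaps/ne/NE3.md` §4.  WHY.  The `sfClass` END on B8's surface
(`Spine/NE3/PairLandauB8EndSfClass.ne3EnergyRateWCov_sfClass_of_pairLandauGaugeB8Avg`) displays, per pair, the hypothesis SHAPE
`TangentProjectionBound L (j+1) W (slicB8 L N (j+1) W) {skew ∧ periodic ∧ TangentIter L j W} K (periodBox (N·L^{j+1}))`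
(`NE3CurlPairedResidualGaugeQuotient`, p342348): every `Y ∈ slicB8(W)` splits as `Y = Y_t + gaugeDir W ζ` with `Y_t` tangent to the PLAIN fibre and
`‖Y_t‖_w ≤ K‖Y‖_w` in the η-weighted energy norm `‖·‖_w = √(curlSq_W + (L^{j+1})⁻²·dirSq)`.  THIS FILE PROVES IT with a k-FREE, N-FREE `K` at every
unitary periodic background of the tower's small-field class — so that displayed hypothesis of the END is DISCHARGED (kinematics, no printed input).

THE MECHANISM (census R25, gen-4 reading).  For `Y ∈ slicB8(W)` the k-fold linearised double-bar average vanishes, so by the covariant structure theorem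
`NE3TangentCovariantTower.dirIter_eq_QbarIter_add_gaugeDir` the k-fold linearised average of `Y` is the COARSE gauge direction of the accumulated frames
`f := framePotW L (j+1) W Y`.  Any fine generator `ζ` with corner values `ζ(L^{j+1}z) = f(z)` therefore makes `Y − gaugeDir W ζ` tangent
(`dirIter_add_gaugeDir`).  In the ENERGY currency the cheapest such `ζ` is the most concentrated one — the CORNER SPIKE (`ζ = f` at the block corners, `0`
elsewhere): its gauge direction lives on the `2d` bonds at each corner, `dirSq (gaugeDir W ζ) ≤ 4d·Σ_z‖f z‖²`, its dressed curl is the plaquette commutator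
`curlSq_W (gaugeDir W ζ) ≤ 4x²·#planes·Σ_z‖f z‖²` (`NE3CurlOfGaugeDir`), and the accumulated frames obey the k-free ℓ² bound
`Σ_z‖f z‖² ≤ 48·d·L·dirSq Y` (`NE3FramePotBoundWClass.sum_norm_framePotW_sq_le_class`, `d ≥ 3`, `L ≥ 2`).  With the weight `(L^{j+1})⁻²` on `dirSq`
and `x·L^{j+1} ≤ 1` every factor of `L^{j+1}` cancels: `‖gaugeDir W ζ‖_w ≤ √(192·d·L·(d + #planes))·‖Y‖_w`.  (The tent interpolant of the gen-3 plan
would cost `(L^{j+1})^{d−2}`; the spike is what the energy currency wants — the located «corner spikes» are harmless in ℓ², harmful only in sup.)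
The Landau clause of `slicB8` is not used: the bound holds on the whole kernel of `QbarIter`.

CONTENT (all [folklore]; 0 sorry; 0 def): §1 corner-spike kinematics (`gaugeDir_neg_fun`, `sum_normSq_spike_eq`, `dirSq_gaugeDir_le_periodic`,
`energyNormW_gaugeDir_sq_le`); §2 tangency of `Y − gaugeDir W ζ` (`tangentIter_sub_gaugeDir_of_QbarIter_eq_zero`); §3 **`tangentProjectionBound_of_QbarIter_kernel`**
and **`tangentProjectionBound_slicB8`** — the bound at any background of the class with `K = 1 + √(192·(d·L)·(d + #(Plane d)))` (N-free, k-free);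
the `sfClass` reading at `W = cavg L U_B` (the END's binder `hproj`, literally) is the companion file `TangentProjectionSlicB8Class`.

HONEST FRAMING.  Lattice kinematics on OUR typed objects (context only: [Balaban1985RegularSpaces] (1.29)∕(1.37) pp. 81–82 — B8's representative leaves the
plain fibre by a coarse gauge rotation; [Balaban1985Averaging] (110)–(120) pp. 31–35).  ONE displayed hypothesis of the `sfClass` END on B8's surface is
discharged; (P♮) on `slicB8` ([Balaban1985BackgroundPropagators] Thm 3.3 TYPE), `PairLandauGaugeB8Avg` ([B8] Thm 2 ∘ [B11] Thm 1 TYPE), the supplier's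
two sup currencies, the covariant root and **NE3 are NOT proved**; spine PROVED 0∕9; finite T⁴ rung (B)+1 — NOT continuum YM on ℝ⁴, NOT infinite volume,
NOT mass gap, NOT `BetaPertH`, NOT Clay.  ABSOLUTE RULE kept (no printed sentence is a hypothesis).  PLACEMENT: `Summits/QuantumFields/BalabanUV/T4Continuum/Spine/NE3/`;
imports accepted modules only; moves nothing.
-/

set_option autoImplicit false

open scoped BigOperators Matrix Matrix.Norms.L2Operator
open Finset

namespace Summit.QuantumFields.BalabanUV.T4Continuum.NE3.TangentProjectionSlicB8

open Literature.MathematicalPhysics.QuantumFieldTheory.Balaban1983to89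
open B7Prop1Explicit B7Prop2Explicit
open T4AveragingDeficitWall (IsUnitaryCfg IsSkewDir SmallField Ad curlSq dirSq)
open T4AveragingDeficitWallBoundary (IsPeriodicCfg periodBox mem_periodBox sum_periodBox_shift)
open AveragingDeficitPeriodicCounting (IsPeriodicDir)
open AveragingDeficitChartCalculus (cavg)
open AveragingDeficitTransport (norm_Ad_of_unitary)
open AveragingDeficitMultiLevelPrep (cavgIter TangentIter tower LevelSmall)
open NE3EnergyWeightedShapes (energyNormW energyNormW_nonneg)
open BlockAveragePushDirGauge (gaugeDir isPeriodicDir_gaugeDir)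
open NE3TangentCovariantStructure (gaugeDir_add_fun)
open NE3TangentCovariantTower (QbarIter framePotW dirIter dirIter_eq_QbarIter_add_gaugeDir dirIter_add_gaugeDir
  tangentIter_iff_dirIter_eq_zero)
open NE3CurvedFrameKill (framePotW_skew_periodic)
open NE3LandauOrbit (gaugeDir_skew)
open NE3FramePotBoundW (tower_eq_pow_mul levelSmall_pred)
open NE3FramePotBoundWClass (sum_norm_framePotW_sq_le_class)
open NE3CovariantLineSumsL2 (l2sq)
open NE3CurlOfGaugeDir (curlSq_gaugeDir_le norm_sub_sq_le)
open NE3ProductPathBounds (energyNormW_sub_le)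
open NE3CurlPairedResidualGaugeQuotient (TangentProjectionBound)
open NE3.PairLandauB8Avg (slicB8 mem_slicB8_iff)

noncomputable section

variable {d : ℕ} {n : Type*} [Fintype n] [DecidableEq n]

/-! ## §1 Corner-spike kinematics -/

/-- `gaugeDir` of the negated generator is the negated direction. [folklore] -/
theorem gaugeDir_neg_fun (W : Site d → Fin d → (Matrix n n ℂ)ˣ) (lam : Site d → Matrix n n ℂ) (z : Site d) (κ : Fin d) :
    gaugeDir W (fun y => -lam y) z κ = -gaugeDir W lam z κ := by
  simp only [gaugeDir, Ad, Matrix.mul_neg, Matrix.neg_mul]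
  abel

/-- **THE ℓ²-MASS OF A CORNER SPIKE**: if `ζ` agrees with `f` at the corners `M•z` and vanishes off the corner lattice, then over the fine period box
`Σ_{x∈periodBox (N·M)} ‖ζ x‖² = Σ_{z∈periodBox N} ‖f z‖²`. [folklore] -/
theorem sum_normSq_spike_eq {M N : ℕ} (hM : 1 ≤ M) {ζ f : Site d → Matrix n n ℂ}
    (hcorner : ∀ z : Site d, ζ ((M : ℤ) • z) = f z) (hoff : ∀ y : Site d, ζ y ≠ 0 → ∃ z : Site d, y = (M : ℤ) • z) :
    ∑ x ∈ periodBox (d := d) (N * M), ‖ζ x‖ ^ 2 = ∑ z ∈ periodBox (d := d) N, ‖f z‖ ^ 2 := by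
  have hM0 : (0 : ℤ) < M := by exact_mod_cast (by omega : 0 < M)
  -- the corner map is injective and lands in the fine box
  have hinj : Set.InjOn (fun z : Site d => (M : ℤ) • z) (periodBox (d := d) N : Set (Site d)) := by
    intro z _ z' _ h
    funext i
    have := congr_fun h i
    simp only [Pi.smul_apply, smul_eq_mul] at this
    exact mul_left_cancel₀ hM0.ne' this
  have himg : ∀ z ∈ periodBox (d := d) N, (M : ℤ) • z ∈ periodBox (d := d) (N * M) := by
    intro z hz
    rw [mem_periodBox] at hz ⊢
    intro κ
    simp only [Pi.smul_apply, smul_eq_mul]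
    push_cast
    obtain ⟨h0, h1⟩ := hz κ
    constructor
    · positivity
    · nlinarith
  symm
  calc ∑ z ∈ periodBox (d := d) N, ‖f z‖ ^ 2 = ∑ z ∈ periodBox (d := d) N, ‖ζ ((M : ℤ) • z)‖ ^ 2 := by
        simp only [hcorner]
    _ = ∑ x ∈ (periodBox (d := d) N).image (fun z : Site d => (M : ℤ) • z), ‖ζ x‖ ^ 2 := by rw [sum_image hinj]
    _ = ∑ x ∈ periodBox (d := d) (N * M), ‖ζ x‖ ^ 2 := by
        refine sum_subset ?_ ?_
        · intro x hx
          obtain ⟨z, hz, rfl⟩ := mem_image.mp hx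
          exact himg z hz
        · intro x hx hx'
          by_contra hne
          have hζ : ζ x ≠ 0 := by
            intro h0; exact hne (by rw [h0, norm_zero]; ring)
          obtain ⟨z, rfl⟩ := hoff x hζ
          refine hx' (mem_image.mpr ⟨z, ?_, rfl⟩)
          rw [mem_periodBox] at hx ⊢
          intro κ
          obtain ⟨h0, h1⟩ := hx κ
          simp only [Pi.smul_apply, smul_eq_mul] at h0 h1
          push_cast at h1
          constructor
          · nlinarith
          · nlinarith

/-- **THE BOND ℓ²-NORM OF A GAUGE DIRECTION ON THE TORUS** (unitary `W`, `P`-periodic generator, `P ≥ 1`):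
`dirSq (gaugeDir W ζ) (periodBox P) ≤ 4d·Σ_{x∈periodBox P} ‖ζ x‖²` (each bond term is `≤ 2‖ζ x‖² + 2‖ζ(x+e_μ)‖²`; the shifted sum is the unshifted
one by periodicity). [folklore] -/
theorem dirSq_gaugeDir_le_periodic {W : Site d → Fin d → (Matrix n n ℂ)ˣ} (hWu : IsUnitaryCfg W) {P : ℕ} (hP : 1 ≤ P)
    {ζ : Site d → Matrix n n ℂ} (hζP : ∀ (x : Site d) (i : Fin d), ζ (x + (P : ℤ) • e i) = ζ x) :
    dirSq (gaugeDir W ζ) (periodBox (d := d) P) ≤ 4 * d * ∑ x ∈ periodBox (d := d) P, ‖ζ x‖ ^ 2 := by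
  unfold dirSq
  have hpt : ∀ (x : Site d) (μ : Fin d), ‖gaugeDir W ζ x μ‖ ^ 2 ≤ 2 * ‖ζ x‖ ^ 2 + 2 * ‖ζ (x + e μ)‖ ^ 2 := by
    intro x μ
    have h := norm_sub_sq_le (Ad (W x μ)⁻¹ (ζ x)) (ζ (x + e μ))
    rw [norm_Ad_of_unitary ((unitaryUnits (Matrix n n ℂ)).inv_mem (hWu x μ))] at h
    exact h
  have hshift : ∀ μ : Fin d, ∑ x ∈ periodBox (d := d) P, ‖ζ (x + e μ)‖ ^ 2 = ∑ x ∈ periodBox (d := d) P, ‖ζ x‖ ^ 2 :=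
    fun μ => sum_periodBox_shift P hP (g := fun x => ‖ζ x‖ ^ 2) (fun x κ => by simp only [hζP]) (e μ)
  have e1 : ∀ x : Site d, ∑ μ : Fin d, (2 * ‖ζ x‖ ^ 2 + 2 * ‖ζ (x + e μ)‖ ^ 2)
      = 2 * d * ‖ζ x‖ ^ 2 + ∑ μ : Fin d, 2 * ‖ζ (x + e μ)‖ ^ 2 := by
    intro x; rw [sum_add_distrib, sum_const, card_univ, Fintype.card_fin, nsmul_eq_mul]; ring
  calc ∑ x ∈ periodBox (d := d) P, ∑ μ : Fin d, ‖gaugeDir W ζ x μ‖ ^ 2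
      ≤ ∑ x ∈ periodBox (d := d) P, ∑ μ : Fin d, (2 * ‖ζ x‖ ^ 2 + 2 * ‖ζ (x + e μ)‖ ^ 2) :=
        sum_le_sum fun x _ => sum_le_sum fun μ _ => hpt x μ
    _ = ∑ x ∈ periodBox (d := d) P, 2 * d * ‖ζ x‖ ^ 2
          + ∑ μ : Fin d, ∑ x ∈ periodBox (d := d) P, 2 * ‖ζ (x + e μ)‖ ^ 2 := by
        simp_rw [e1]; rw [sum_add_distrib, sum_comm]
    _ = ∑ x ∈ periodBox (d := d) P, 2 * d * ‖ζ x‖ ^ 2 + ∑ _μ : Fin d, 2 * ∑ x ∈ periodBox (d := d) P, ‖ζ x‖ ^ 2 := by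
        congr 1
        refine sum_congr rfl fun μ _ => ?_
        rw [← mul_sum, hshift μ]
    _ = 4 * d * ∑ x ∈ periodBox (d := d) P, ‖ζ x‖ ^ 2 := by
        rw [sum_const, card_univ, Fintype.card_fin, nsmul_eq_mul, ← mul_sum]; ring

/-- **THE WEIGHTED ENERGY OF A GAUGE DIRECTION ON THE TORUS** (unitary `W` with `SmallField W a`, `P`-periodic generator, `P ≥ 1`):
`energyNormW L k W (gaugeDir W ζ) (periodBox P)² ≤ (4a²·#(Plane d) + 4d·(L^k)⁻²)·Σ_{x∈periodBox P}‖ζ x‖²` — the dressed curl of a gauge direction is the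
plaquette commutator (`NE3CurlOfGaugeDir.curlSq_gaugeDir_le`), the bond term is `dirSq_gaugeDir_le_periodic`. [folklore] -/
theorem energyNormW_gaugeDir_sq_le [Nonempty n] (L k : ℕ) {W : Site d → Fin d → (Matrix n n ℂ)ˣ} (hWu : IsUnitaryCfg W) {a : ℝ}
    (hWa : SmallField W a) {P : ℕ} (hP : 1 ≤ P) {ζ : Site d → Matrix n n ℂ}
    (hζP : ∀ (x : Site d) (i : Fin d), ζ (x + (P : ℤ) • e i) = ζ x) :
    energyNormW L k W (gaugeDir W ζ) (periodBox (d := d) P) ^ 2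
      ≤ (4 * a ^ 2 * (Fintype.card (T4AveragingDeficitWall.Plane d)) + 4 * d * (((L : ℝ) ^ k)⁻¹) ^ 2)
          * ∑ x ∈ periodBox (d := d) P, ‖ζ x‖ ^ 2 := by
  have hc := curlSq_gaugeDir_le hWu hWa ζ (periodBox (d := d) P)
  have hb := dirSq_gaugeDir_le_periodic hWu hP hζP
  have hC0 : 0 ≤ curlSq W (gaugeDir W ζ) (periodBox (d := d) P) := by unfold curlSq; positivity
  have hD0 : 0 ≤ dirSq (gaugeDir W ζ) (periodBox (d := d) P) := by unfold dirSq; positivity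
  have hw0 : 0 ≤ (((L : ℝ) ^ k)⁻¹) ^ 2 := sq_nonneg _
  unfold energyNormW
  rw [Real.sq_sqrt (add_nonneg hC0 (mul_nonneg hw0 hD0))]
  have hwb := mul_le_mul_of_nonneg_left hb hw0
  nlinarith

/-! ## §2 Tangency of the corrected direction -/

/-- **A GENERATOR WITH THE ACCUMULATED FRAMES AS CORNER VALUES MAKES `Y − gaugeDir W ζ` TANGENT TO THE PLAIN FIBRE** (unitary `W` of period
`tower L N (j+1) = L^{j+1}·N` in the multi-level small-field class; `Y` skew periodic with `QbarIter L (j+1) W Y = 0`; `ζ` skew periodic with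
`ζ (L^{j+1}•z) = framePotW L (j+1) W Y z`): `TangentIter L j W (Y − gaugeDir W ζ)` — the structure theorem `dirIter = QbarIter + gaugeDir_V ∘ framePotW`
and `dirIter_add_gaugeDir`. [folklore] -/
theorem tangentIter_sub_gaugeDir_of_QbarIter_eq_zero [Nonempty n] {L N : ℕ} [NeZero N] (hL : 1 ≤ L) (j : ℕ)
    {W : Site d → Fin d → (Matrix n n ℂ)ˣ} {x : ℝ} (hWu : IsUnitaryCfg W) (hWP : IsPeriodicCfg W ((tower L N (j + 1) : ℕ) : ℤ))
    (hx : 0 ≤ x) (hs : LevelSmall d L j x) (hWx : SmallField W x) {Y : Site d → Fin d → Matrix n n ℂ} (hY : IsSkewDir Y)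
    (hYP : IsPeriodicDir Y ((tower L N (j + 1) : ℕ) : ℤ)) (hQ : QbarIter L (j + 1) W Y = fun _ _ => 0)
    {ζ : Site d → Matrix n n ℂ} (hζs : ∀ y, ζ y ∈ skewAdjoint (Matrix n n ℂ))
    (hζP : ∀ (y : Site d) (i : Fin d), ζ (y + ((tower L N (j + 1) : ℕ) : ℤ) • e i) = ζ y)
    (hcorner : ∀ z : Site d, ζ (((L : ℤ) ^ (j + 1)) • z) = framePotW L (j + 1) W Y z) :
    TangentIter L j W (Y - gaugeDir W ζ) := by
  rw [tangentIter_iff_dirIter_eq_zero]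
  have hneg_s : ∀ y, (fun y => -ζ y) y ∈ skewAdjoint (Matrix n n ℂ) := fun y => (skewAdjoint (Matrix n n ℂ)).neg_mem (hζs y)
  have hneg_P : ∀ (y : Site d) (i : Fin d), (fun y => -ζ y) (y + ((tower L N (j + 1) : ℕ) : ℤ) • e i) = (fun y => -ζ y) y := by
    intro y i; simp only [hζP]
  have hform : Y - gaugeDir W ζ = fun y ν => Y y ν + gaugeDir W (fun y => -ζ y) y ν := by
    funext y ν
    rw [Pi.sub_apply, Pi.sub_apply, gaugeDir_neg_fun, sub_eq_add_neg]
  have hstruct := dirIter_eq_QbarIter_add_gaugeDir (M := N) hL j hWu hWP hx hs hWx hY hYP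
  rw [hform, dirIter_add_gaugeDir (M := N) hL j hWu hWP hx hs hWx Y hneg_s hneg_P, hstruct, hQ]
  funext z κ
  simp only [hcorner, zero_add, Pi.zero_apply]
  rw [← gaugeDir_add_fun]
  simp [gaugeDir, Ad]

/-! ## §3 The tangent projection bound on the kernel of the k-fold double-bar average, hence on B8's slice -/

set_option maxHeartbeats 400000 in
/-- **R25 — THE TANGENT PROJECTION BOUND ON THE KERNEL OF THE k-FOLD LINEARISED DOUBLE-BAR AVERAGE, k-FREE** (`3 ≤ d`, `2 ≤ L`, `1 ≤ N`; a unitary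
`(N·L^{j+1})`-periodic background `W` of the tower's small-field class — `0 ≤ x`, `LevelSmall d L j x`, `SmallField W x` — with `x·L^{j+1} ≤ 1`): every skew
`(N·L^{j+1})`-periodic `Y` with `QbarIter L (j+1) W Y = 0` splits as `Y = Y_t + gaugeDir W ζ` with `Y_t` skew, periodic, TANGENT TO THE PLAIN FIBRE
(`TangentIter L j W Y_t`) and `‖Y_t‖_w ≤ (1 + √(192·(d·L)·(d + #(Plane d))))·‖Y‖_w` over the period box — `ζ` the corner spike of the accumulated frames.
N-free, k-free, `x`-free. [folklore] -/
theorem tangentProjectionBound_of_QbarIter_kernel [Nonempty n] (hd : 3 ≤ d) {L N : ℕ} [NeZero N] (hL : 2 ≤ L) (hN : 1 ≤ N) (j : ℕ)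
    {W : Site d → Fin d → (Matrix n n ℂ)ˣ} {x : ℝ} (hWu : IsUnitaryCfg W) (hWP : IsPeriodicCfg W ((N * L ^ (j + 1) : ℕ) : ℤ))
    (hx : 0 ≤ x) (hs : LevelSmall d L j x) (hWx : SmallField W x) (hxM : x * (L : ℝ) ^ (j + 1) ≤ 1) :
    TangentProjectionBound L (j + 1) W
      {Y | IsSkewDir Y ∧ IsPeriodicDir Y ((N * L ^ (j + 1) : ℕ) : ℤ) ∧ QbarIter L (j + 1) W Y = fun _ _ => 0}
      {Y | IsSkewDir Y ∧ IsPeriodicDir Y ((N * L ^ (j + 1) : ℕ) : ℤ) ∧ TangentIter L j W Y}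
      (1 + Real.sqrt (192 * ((d : ℝ) * L) * (d + Fintype.card (T4AveragingDeficitWall.Plane d))))
      (periodBox (N * L ^ (j + 1))) := by
  intro Y hY
  obtain ⟨hYs, hYP, hQ⟩ := hY
  have hL1 : 1 ≤ L := by omega
  set M : ℕ := L ^ (j + 1) with hM
  have hMpos : 0 < M := by rw [hM]; positivity
  have hM1 : 1 ≤ M := hMpos
  have hM0 : (M : ℤ) ≠ 0 := by exact_mod_cast hMpos.ne'
  have hMZ : ((M : ℕ) : ℤ) = (L : ℤ) ^ (j + 1) := by rw [hM]; push_cast; rfl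
  have htower : tower L N (j + 1) = M * N := by rw [tower_eq_pow_mul]
  have hNM : N * M = M * N := Nat.mul_comm _ _
  -- periodicity in the forms the tree's lemmas want
  have hWP_MN : IsPeriodicCfg W ((M * N : ℕ) : ℤ) := by rw [← hNM]; exact hWP
  have hYP_MN : IsPeriodicDir Y ((M * N : ℕ) : ℤ) := by rw [← hNM]; exact hYP
  have hWP_T : IsPeriodicCfg W ((tower L N (j + 1) : ℕ) : ℤ) := by rw [htower]; exact hWP_MN
  have hYP_T : IsPeriodicDir Y ((tower L N (j + 1) : ℕ) : ℤ) := by rw [htower]; exact hYP_MN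
  -- the accumulated frames: skew and `N`-periodic
  obtain ⟨hfs, hfP⟩ := framePotW_skew_periodic (M := N) hL1 j hWu hWP_T hx hs hWx hYs hYP_T
  -- the corner spike of the accumulated frames
  set f : Site d → Matrix n n ℂ := framePotW L (j + 1) W Y with hf
  set ζ : Site d → Matrix n n ℂ := fun y => if (∀ i, (M : ℤ) ∣ y i) then f (fun i => y i / (M : ℤ)) else 0 with hζ
  have hζ_of : ∀ y : Site d, (∀ i, (M : ℤ) ∣ y i) → ζ y = f (fun i => y i / (M : ℤ)) := fun y h => by
    simp only [hζ, if_pos h]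
  have hζ_off : ∀ y : Site d, ¬ (∀ i, (M : ℤ) ∣ y i) → ζ y = 0 := fun y h => by
    simp only [hζ, if_neg h]
  have hcorner : ∀ z : Site d, ζ ((M : ℤ) • z) = f z := by
    intro z
    have hdiv : ∀ i, (M : ℤ) ∣ ((M : ℤ) • z) i := fun i => by
      simp only [Pi.smul_apply, smul_eq_mul]; exact dvd_mul_right _ _
    rw [hζ_of _ hdiv]
    congr 1
    funext i
    simp only [Pi.smul_apply, smul_eq_mul]
    exact Int.mul_ediv_cancel_left _ hM0
  have hcorner' : ∀ z : Site d, ζ (((L : ℤ) ^ (j + 1)) • z) = framePotW L (j + 1) W Y z := by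
    intro z; rw [← hMZ]; exact hcorner z
  have hoff : ∀ y : Site d, ζ y ≠ 0 → ∃ z : Site d, y = (M : ℤ) • z := by
    intro y hy
    by_cases hdiv : ∀ i, (M : ℤ) ∣ y i
    · refine ⟨fun i => y i / (M : ℤ), ?_⟩
      funext i
      simp only [Pi.smul_apply, smul_eq_mul]
      exact (Int.mul_ediv_cancel' (hdiv i)).symm
    · exact absurd (hζ_off y hdiv) hy
  have hζs : ∀ y, ζ y ∈ skewAdjoint (Matrix n n ℂ) := by
    intro y
    by_cases hdiv : ∀ i, (M : ℤ) ∣ y i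
    · rw [hζ_of y hdiv]; exact hfs _
    · rw [hζ_off y hdiv]; exact (skewAdjoint (Matrix n n ℂ)).zero_mem
  have hζP : ∀ (y : Site d) (i : Fin d), ζ (y + ((M * N : ℕ) : ℤ) • e i) = ζ y := by
    intro y i
    have hcoord : ∀ k : Fin d, (y + ((M * N : ℕ) : ℤ) • e i) k = y k + (M : ℤ) * ((N : ℤ) * e i k) := by
      intro k; simp only [Pi.add_apply, Pi.smul_apply, smul_eq_mul]; push_cast; ring
    have hdiv_iff : (∀ k, (M : ℤ) ∣ (y + ((M * N : ℕ) : ℤ) • e i) k) ↔ ∀ k, (M : ℤ) ∣ y k := by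
      refine forall_congr' fun k => ?_
      rw [hcoord]
      constructor
      · intro h
        have h' := dvd_sub h (dvd_mul_right (M : ℤ) ((N : ℤ) * e i k))
        rwa [add_sub_cancel_right] at h'
      · intro h
        exact dvd_add h (dvd_mul_right _ _)
    by_cases hdiv : ∀ k, (M : ℤ) ∣ y k
    · rw [hζ_of _ (hdiv_iff.mpr hdiv), hζ_of _ hdiv]
      have hq : (fun k => (y + ((M * N : ℕ) : ℤ) • e i) k / (M : ℤ)) = (fun k => y k / (M : ℤ)) + (N : ℤ) • e i := by
        funext k
        rw [hcoord, Int.add_mul_ediv_left _ _ hM0]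
        simp only [Pi.add_apply, Pi.smul_apply, smul_eq_mul]
      rw [hq, hfP]
    · rw [hζ_off _ hdiv, hζ_off _ (fun h => hdiv (hdiv_iff.mp h))]
  have hζP' : ∀ (y : Site d) (i : Fin d), ζ (y + ((N * M : ℕ) : ℤ) • e i) = ζ y := by rw [hNM]; exact hζP
  have hζP_T : ∀ (y : Site d) (i : Fin d), ζ (y + ((tower L N (j + 1) : ℕ) : ℤ) • e i) = ζ y := by rw [htower]; exact hζP
  -- the split
  set G : Site d → Fin d → Matrix n n ℂ := gaugeDir W ζ with hG
  have hGP : IsPeriodicDir G ((N * M : ℕ) : ℤ) := isPeriodicDir_gaugeDir hWP hζP'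
  refine ⟨Y - G, ζ, ⟨?_, ?_, ?_⟩, (sub_add_cancel Y G).symm, ?_⟩
  · intro y μ
    rw [Pi.sub_apply, Pi.sub_apply]
    exact (skewAdjoint _).sub_mem (hYs y μ) (gaugeDir_skew hWu hζs y μ)
  · intro y κ μ
    simp only [Pi.sub_apply, hYP y κ μ, hGP y κ μ]
  · exact tangentIter_sub_gaugeDir_of_QbarIter_eq_zero hL1 j hWu hWP_T hx hs hWx hYs hYP_T hQ hζs hζP_T hcorner'
  -- the bound
  set F : Finset (Site d) := periodBox (d := d) (N * M) with hF
  set P : ℝ := (Fintype.card (T4AveragingDeficitWall.Plane d) : ℝ) with hPdef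
  set C : ℝ := 192 * ((d : ℝ) * L) * (d + P) with hC
  set ξ : ℝ := ((L : ℝ) ^ (j + 1))⁻¹ with hξ
  have hP0 : 0 ≤ P := by rw [hPdef]; positivity
  have hC0 : 0 ≤ C := by rw [hC]; positivity
  have hY0 : 0 ≤ energyNormW L (j + 1) W Y F := energyNormW_nonneg _ _ _ _ _
  have hG0 : 0 ≤ energyNormW L (j + 1) W G F := energyNormW_nonneg _ _ _ _ _
  have hLM : (0 : ℝ) < (L : ℝ) ^ (j + 1) := by positivity
  have hξ0 : 0 ≤ ξ := by rw [hξ]; positivity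
  have hNM1 : 1 ≤ N * M := Nat.one_le_iff_ne_zero.mpr (Nat.mul_ne_zero (by omega) hMpos.ne')
  -- `x ≤ ξ`
  have hxξ : x ≤ ξ := by rw [hξ, ← one_div]; exact (le_div_iff₀ hLM).mpr hxM
  -- (1) the spike's ℓ²-mass is the ℓ²-mass of the accumulated frames, bounded by the k-free frame bound
  have hS : ∑ y ∈ F, ‖ζ y‖ ^ 2 = ∑ z ∈ periodBox (d := d) N, ‖f z‖ ^ 2 := sum_normSq_spike_eq (N := N) hM1 hcorner hoff
  have hD0 : 0 ≤ dirSq Y F := by unfold dirSq; positivity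
  have hfr : ∑ z ∈ periodBox (d := d) N, ‖f z‖ ^ 2 ≤ 48 * ((d : ℝ) * L) * dirSq Y F := by
    have h := sum_norm_framePotW_sq_le_class hd hL hN j hWu hWP_MN hx hs hWx hYP_MN
    have e : l2sq (periodBox (d := d) (M * N)) Y = dirSq Y F := by rw [hF, hNM]; rfl
    rw [e] at h
    exact h
  -- (2) the weighted energy of the spike's gauge direction
  have hG2 : energyNormW L (j + 1) W G F ^ 2 ≤ C * (ξ ^ 2 * dirSq Y F) := by
    have h1 := energyNormW_gaugeDir_sq_le L (j + 1) hWu hWx hNM1 hζP'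
    have hS0 : 0 ≤ ∑ y ∈ F, ‖ζ y‖ ^ 2 := by positivity
    have hx2 : x ^ 2 ≤ ξ ^ 2 := pow_le_pow_left₀ hx hxξ 2
    have hcoef : 4 * x ^ 2 * P + 4 * d * ξ ^ 2 ≤ 4 * (P + d) * ξ ^ 2 := by nlinarith
    calc energyNormW L (j + 1) W G F ^ 2 ≤ (4 * x ^ 2 * P + 4 * d * ξ ^ 2) * ∑ y ∈ F, ‖ζ y‖ ^ 2 := h1
      _ ≤ 4 * (P + d) * ξ ^ 2 * ∑ y ∈ F, ‖ζ y‖ ^ 2 := mul_le_mul_of_nonneg_right hcoef hS0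
      _ ≤ 4 * (P + d) * ξ ^ 2 * (48 * ((d : ℝ) * L) * dirSq Y F) := by
          rw [hS]; exact mul_le_mul_of_nonneg_left hfr (by positivity)
      _ = C * (ξ ^ 2 * dirSq Y F) := by rw [hC]; ring
  have hY2 : ξ ^ 2 * dirSq Y F ≤ energyNormW L (j + 1) W Y F ^ 2 := by
    have hc0 : 0 ≤ curlSq W Y F := by unfold curlSq; positivity
    have e : energyNormW L (j + 1) W Y F ^ 2 = curlSq W Y F + ξ ^ 2 * dirSq Y F := by
      unfold energyNormW
      exact Real.sq_sqrt (add_nonneg hc0 (mul_nonneg (sq_nonneg _) hD0))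
    rw [e]
    linarith
  have hGle : energyNormW L (j + 1) W G F ≤ Real.sqrt C * energyNormW L (j + 1) W Y F := by
    have h : energyNormW L (j + 1) W G F ^ 2 ≤ C * energyNormW L (j + 1) W Y F ^ 2 :=
      hG2.trans (mul_le_mul_of_nonneg_left hY2 hC0)
    calc energyNormW L (j + 1) W G F = Real.sqrt (energyNormW L (j + 1) W G F ^ 2) := (Real.sqrt_sq hG0).symm
      _ ≤ Real.sqrt (C * energyNormW L (j + 1) W Y F ^ 2) := Real.sqrt_le_sqrt h
      _ = Real.sqrt C * energyNormW L (j + 1) W Y F := by rw [Real.sqrt_mul hC0, Real.sqrt_sq hY0]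
  -- (3) Minkowski
  calc energyNormW L (j + 1) W (Y - G) F ≤ energyNormW L (j + 1) W Y F + energyNormW L (j + 1) W G F :=
        energyNormW_sub_le _ _ _ _ _ _
    _ ≤ energyNormW L (j + 1) W Y F + Real.sqrt C * energyNormW L (j + 1) W Y F := by linarith
    _ = (1 + Real.sqrt C) * energyNormW L (j + 1) W Y F := by ring

/-- **R25 — THE TANGENT PROJECTION BOUND ON B8's SLICE `slicB8`, k-FREE**: under the hypotheses of `tangentProjectionBound_of_QbarIter_kernel`,
`TangentProjectionBound L (j+1) W (slicB8 L N (j+1) W) {skew ∧ periodic ∧ TangentIter L j W} (1 + √(192·(d·L)·(d + #(Plane d)))) (periodBox (N·L^{j+1}))`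
— `slicB8(W)` lies in the kernel of `QbarIter L (j+1) W` (its Landau clause is not needed). [folklore] -/
theorem tangentProjectionBound_slicB8 [Nonempty n] (hd : 3 ≤ d) {L N : ℕ} [NeZero N] (hL : 2 ≤ L) (hN : 1 ≤ N) (j : ℕ)
    {W : Site d → Fin d → (Matrix n n ℂ)ˣ} {x : ℝ} (hWu : IsUnitaryCfg W) (hWP : IsPeriodicCfg W ((N * L ^ (j + 1) : ℕ) : ℤ))
    (hx : 0 ≤ x) (hs : LevelSmall d L j x) (hWx : SmallField W x) (hxM : x * (L : ℝ) ^ (j + 1) ≤ 1) :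
    TangentProjectionBound L (j + 1) W (slicB8 L N (j + 1) W)
      {Y | IsSkewDir Y ∧ IsPeriodicDir Y ((N * L ^ (j + 1) : ℕ) : ℤ) ∧ TangentIter L j W Y}
      (1 + Real.sqrt (192 * ((d : ℝ) * L) * (d + Fintype.card (T4AveragingDeficitWall.Plane d))))
      (periodBox (N * L ^ (j + 1))) := by
  intro Y hY
  rw [mem_slicB8_iff] at hY
  exact tangentProjectionBound_of_QbarIter_kernel hd hL hN j hWu hWP hx hs hWx hxM Y ⟨hY.1, hY.2.1, hY.2.2.2⟩

end

end Summit.QuantumFields.BalabanUV.T4Continuum.NE3.TangentProjectionSlicB8
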